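import Literature.Probability.LatticeModels.DobrushinMetricStates
import HarnessLib

/-!
# Dobrushin's comparison and covariance estimates in the Vasserstein form under the WEIGHTED
(Künsch / Georgii 8.26) row-sum condition

Third file of the Vasserstein (Kantorovich–Rubinstein) form of Dobrushin's contraction technique
(`DobrushinComparisonMetric.lean`: the abstract dusting data `DobrushinMetric.DustingData`, estimates,
the sweep `Φ` and the PROFILE form of the comparison theorem; `DobrushinMetricStates.lean`: the
dusting data `krDustingData` of a specification satisfying Dobrushin's condition in the Vasserstein
form `IsKRContraction`, invariant states, uniqueness and the covariance estimate
`abs_covariance_le_of_isKRContraction`).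

The landed profile form decays like `c ^ ℓ(y)` along an `ℕ`-valued profile `ℓ` that vanishes off the
usable sites `W` and drops by at most one along the support of the influence coefficients
(`ℓ x ≤ ℓ y + 1` for `y ∈ nbr x`). When every site influences every other one (`nbr x = V ∖ {x}` on
a finite torus, as for a perturbed lattice action whose local terms have unbounded diameter but
exponentially small size) such a profile is `≤ 1` off `W`: no decay. The remedy is printed in
Föllmer's notes right after the covariance estimate (LNM 1362, Ch. I, Cor. (2.14), "following
L. Gross", and (2.24) for the Vasserstein version): replace Dobrushin's constant
`c = sup_k ∑_i C_{ik}` by the WEIGHTED constant `κ̄ := sup_k ∑_i e^{d(i,k)} C_{ik}` for a semimetric `d`;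
if `κ̄ < 1` the correlations of the unique Gibbs measure decay exponentially in `d`. Georgii (2011,
Remark 8.26) and Künsch (1982) phrase the same device as a weighted row-sum condition
`∑_y C x y θ y ≤ c θ x`. This file proves that form for the abstract dusting data and then for
Gibbs measures of a specification satisfying `IsKRContraction`, exactly parallel to the landed
profile theorems (and to the total-variation / cell version `DobrushinCellWeightedDecay.lean`):

* `DobrushinMetric.DustingData.iterate_phi_le_weighted` — **the weighted contraction**: rows
  `≤ c ≤ 1` on `W`, a weight `θ ≥ 0` with `θ ≥ 1` off `W` and `∑_{y ∈ nbr x} C x y θ y ≤ c θ x` on `W`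
  give `(Φⁿ R)_y ≤ R (cⁿ + θ y)` (twin of `iterate_phi_le_pow`).
* `DobrushinMetric.DustingData.abs_sub_le_sum_weighted` — the comparison estimate
  `|E₁ f - E₂ f| ≤ R ∑_{y ∈ Δ} θ y δ y` for two invariant states when `c < 1`
  (twin of `abs_sub_le_sum_pow_profile`).
* `DobrushinMetric.DustingData.abs_sub_le_sum_exp_profile` — the same with the REAL profile
  `θ = e^{-t ρ}`: `ρ ≤ 0` off `W`, `ρ x ≤ ρ y + d x y` along `nbr`, and the weighted row-sum condition
  `∑_{y ∈ nbr x} C x y e^{t d x y} ≤ c` on `W` (Föllmer's `κ̄ ≤ c`); `d` is any nonnegative function on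
  the pairs `(x, y)`, `y ∈ nbr x` (a lattice distance in applications), `ρ` any such profile (the
  distance to `V ∖ W`).
* `DobrushinMetric.abs_covariance_le_of_isKRContraction_weighted` /
  `…_exp_profile` / `…_exp_dist` / `…_infDist` — **covariance decay for a Gibbs measure** of a
  specification satisfying Dobrushin's condition in the Vasserstein form, under the weighted
  row-sum condition off the dependence set `Δ_g` of `g`:
  `|cov_μ(f, g)| ≤ 2 R² (∑_{Δ_g} δ_g) ∑_{y ∈ Δ_f} θ y δ_f y`, resp. with `θ y = e^{-t ρ y}`, resp.
  `≤ 2 R² (∑ δ_g) (∑ δ_f) e^{-t m}` when `ρ ≥ m` on `Δ_f`, resp. with `ρ = infDist(·, Δ_g)` for a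
  pseudo-metric on the sites (twins of `abs_covariance_le_of_isKRContraction`; the tilt trick of
  Föllmer 1988 Ch. I Thm. (2.13)).

Theorems only: no definition, no named fact. The finite sets `nbr x` of `IsKRContraction` are kept
(on a finite volume they may be all other sites); the countable-range version (infinite `nbr x` with
summable rows, Föllmer's condition (2.6)/(2.7) verbatim on `ℤ^d`) needs estimates with infinite sums
and is deliberately NOT here.

## References

* H. Föllmer, *Random fields and diffusion processes*, École d'Été de Probabilités de Saint-Flour
  XV–XVII, LNM 1362 (1988), Ch. I §2: Lemma (2.5), Comparison Theorem (2.8), Theorem (2.13),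
  Corollary (2.14) (the weighted constant `κ̄`), Remark (2.17) with (2.20)–(2.24) (Vasserstein
  version; (2.24) = exponential decay under `κ̄ < 1`).
* H.-O. Georgii, *Gibbs Measures and Phase Transitions*, 2nd ed. (2011), Thm. 8.20, Remark 8.26,
  §8.2 (weighted row sums).
* H. Künsch, *Decay of correlations under Dobrushin's uniqueness condition and its applications*,
  Comm. Math. Phys. 84 (1982) 207–222.
* L. Gross, *Decay of correlations in classical lattice models at high temperature*,
  Comm. Math. Phys. 68 (1979) 9–27 (cited after Föllmer).
-/

noncomputable section

open MeasureTheory ProbabilityTheory Finset Function Filter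
open scoped Topology

namespace Literature.Probability.LatticeModels

namespace DobrushinMetric

variable {V S : Type*}

/-! ### The abstract layer: the weighted contraction of Föllmer's iterates -/

namespace DustingData

variable [DecidableEq V] {D : DustingData V S} {E₁ E₂ : ((V → S) → ℝ) → ℝ}

/-- Off the usable sites the iterates `Φⁿ R` never move: `(Φⁿ R)_y = R` for `y ∉ W`. [folklore] -/
private theorem iterate_phi_apply_of_not_mem (n : ℕ) {y : V} (hy : y ∉ D.W) :
    (D.phi^[n] fun _ => D.R) y = D.R := by
  induction n with
  | zero => rfl
  | succ n ih => rw [Function.iterate_succ_apply', D.phi_apply_of_not_mem hy, ih]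

/-- **The weighted contraction** (Föllmer 1988, Ch. I, Cor. (2.14): `∑_i e^{d(i,k)} Cⁿ_{ik} ≤ κ̄ⁿ`;
Georgii 2011, Remark 8.26; Künsch 1982 — vector form for a general set `W` of usable sites, twin
of `iterate_phi_le_pow`): if the rows of `C` sum to at most `c ∈ [0, 1]` on `W` and a weight
`θ ≥ 0` with `θ ≥ 1` off `W` satisfies the WEIGHTED row-sum condition
`∑_{y ∈ nbr x} C x y θ y ≤ c θ x` on `W`, then `(Φⁿ R)_y ≤ R (cⁿ + θ y)` for all `n` and `y`.
[cite: Follmer1988, Ch. I Corollary (2.14)] -/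
theorem iterate_phi_le_weighted {c : ℝ} (hc0 : 0 ≤ c) (hc1 : c ≤ 1)
    (hrow : ∀ x ∈ D.W, ∑ y ∈ D.nbr x, D.C x y ≤ c) {θ : V → ℝ} (hθ0 : ∀ y, 0 ≤ θ y)
    (hθW : ∀ y ∉ D.W, 1 ≤ θ y)
    (hroww : ∀ x ∈ D.W, ∑ y ∈ D.nbr x, D.C x y * θ y ≤ c * θ x) (n : ℕ) (y : V) :
    (D.phi^[n] fun _ => D.R) y ≤ D.R * (c ^ n + θ y) := by
  induction n generalizing y with
  | zero =>
    simp only [Function.iterate_zero, id_eq, pow_zero]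
    nlinarith [hθ0 y, D.R_nonneg]
  | succ n ih =>
    by_cases hy : y ∈ D.W
    · rw [Function.iterate_succ_apply', D.phi_apply_of_mem hy, rowC]
      calc ∑ z ∈ D.nbr y, D.C y z * (D.phi^[n] fun _ => D.R) z
          ≤ ∑ z ∈ D.nbr y, D.C y z * (D.R * (c ^ n + θ z)) :=
            Finset.sum_le_sum fun z _ => mul_le_mul_of_nonneg_left (ih z) (D.C_nonneg y z)
        _ = D.R * c ^ n * ∑ z ∈ D.nbr y, D.C y z + D.R * ∑ z ∈ D.nbr y, D.C y z * θ z := by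
            rw [Finset.mul_sum, Finset.mul_sum, ← Finset.sum_add_distrib]
            exact Finset.sum_congr rfl fun z _ => by ring
        _ ≤ D.R * c ^ n * c + D.R * (c * θ y) :=
            add_le_add (mul_le_mul_of_nonneg_left (hrow y hy) (mul_nonneg D.R_nonneg (pow_nonneg hc0 n)))
              (mul_le_mul_of_nonneg_left (hroww y hy) D.R_nonneg)
        _ ≤ D.R * (c ^ (n + 1) + θ y) := by
            have h1 : c * θ y ≤ θ y := by nlinarith [hθ0 y]
            have h2 : D.R * (c * θ y) ≤ D.R * θ y := mul_le_mul_of_nonneg_left h1 D.R_nonneg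
            rw [pow_succ]
            linarith
    · rw [iterate_phi_apply_of_not_mem (n + 1) hy]
      nlinarith [hθW y hy, D.R_nonneg, pow_nonneg hc0 (n + 1)]

/-- **Dobrushin's comparison estimate under the weighted row-sum condition, Vasserstein form**
(Föllmer 1988, Ch. I, Comparison Theorem (2.8) with Cor. (2.14) and Remark (2.17); Georgii 2011,
Remark 8.26 — twin of `abs_sub_le_sum_pow_profile`): for two invariant states of the dusting data,
with row sums `≤ c < 1` on `W` and a weight `θ ≥ 0`, `θ ≥ 1` off `W`, satisfying
`∑_{y ∈ nbr x} C x y θ y ≤ c θ x` on `W`, every admissible `f` with dependence set `Δ` and Lipschitz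
bound `δ` vanishing off `Δ` satisfies `|E₁ f - E₂ f| ≤ R ∑_{y ∈ Δ} θ y δ y`.
[cite: Follmer1988, Ch. I Comparison Theorem (2.8)] -/
theorem abs_sub_le_sum_weighted (h₁ : D.IsInvariantState E₁) (h₂ : D.IsInvariantState E₂)
    {c : ℝ} (hc0 : 0 ≤ c) (hc1 : c < 1) (hrow : ∀ x ∈ D.W, ∑ y ∈ D.nbr x, D.C x y ≤ c)
    {θ : V → ℝ} (hθ0 : ∀ y, 0 ≤ θ y) (hθW : ∀ y ∉ D.W, 1 ≤ θ y)
    (hroww : ∀ x ∈ D.W, ∑ y ∈ D.nbr x, D.C x y * θ y ≤ c * θ x)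
    {f : (V → S) → ℝ} {Δ : Finset V} {δ : V → ℝ} (hf : D.P f Δ) (hδ : IsLipBound D.r f δ)
    (hδ0 : ∀ y ∉ Δ, δ y = 0) :
    |E₁ f - E₂ f| ≤ D.R * ∑ y ∈ Δ, θ y * δ y := by
  -- the estimate after `n` sweeps, bounded by the weighted profile
  have hB : ∀ n : ℕ, |E₁ f - E₂ f| ≤ D.R * c ^ n * ∑ y ∈ Δ, δ y + D.R * ∑ y ∈ Δ, θ y * δ y :=
    fun n => by
    obtain ⟨hest, -⟩ := isEstimate_iterate_phi h₁ h₂ n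
    refine (hest hf hδ hδ0).trans ?_
    rw [Finset.mul_sum, Finset.mul_sum, ← Finset.sum_add_distrib]
    refine Finset.sum_le_sum fun y _ => ?_
    have h1 : (D.phi^[n] fun _ => D.R) y ≤ D.R * (c ^ n + θ y) :=
      iterate_phi_le_weighted hc0 hc1.le hrow hθ0 hθW hroww n y
    have h2 : (D.phi^[n] fun _ => D.R) y * δ y ≤ D.R * (c ^ n + θ y) * δ y :=
      mul_le_mul_of_nonneg_right h1 (hδ.nonneg y)
    refine h2.trans (le_of_eq ?_)
    ring
  have hlim : Tendsto (fun n : ℕ => D.R * c ^ n * ∑ y ∈ Δ, δ y + D.R * ∑ y ∈ Δ, θ y * δ y)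
      atTop (𝓝 (D.R * 0 * ∑ y ∈ Δ, δ y + D.R * ∑ y ∈ Δ, θ y * δ y)) :=
    ((((tendsto_pow_atTop_nhds_zero_of_lt_one hc0 hc1).const_mul D.R).mul_const _).add_const _)
  have h := ge_of_tendsto' hlim hB
  simpa using h

/-- **Comparison estimate with an exponential weight along a real profile** (Föllmer 1988, Ch. I,
Cor. (2.14) and (2.24): the weighted constant `κ̄ = sup_k ∑_i e^{d(i,k)} C_{ik} < 1` gives
exponential decay in the semimetric `d`; Georgii 2011, Remark 8.26 — the real-valued twin of the
`ℕ`-profile `ℓ` of `abs_sub_le_sum_pow_profile`): let `d x y ≥ 0` for `y ∈ nbr x` (`x ∈ W`),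
`t ≥ 0`, and suppose the WEIGHTED ROW SUMS satisfy `∑_{y ∈ nbr x} C x y e^{t d x y} ≤ c < 1` on
`W`; let `ρ : V → ℝ` be a profile with `ρ ≤ 0` off `W` and `ρ x ≤ ρ y + d x y` for `y ∈ nbr x`,
`x ∈ W` (e.g. the `d`-distance to `V ∖ W`). Then two invariant states differ on an admissible `f`
with dependence set `Δ` and Lipschitz bound `δ` vanishing off `Δ` by at most
`R ∑_{y ∈ Δ} e^{-t ρ y} δ y`. [cite: Follmer1988, Ch. I Corollary (2.14)] -/
theorem abs_sub_le_sum_exp_profile (h₁ : D.IsInvariantState E₁) (h₂ : D.IsInvariantState E₂)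
    {c : ℝ} (hc0 : 0 ≤ c) (hc1 : c < 1) (d : V → V → ℝ)
    (hd : ∀ x ∈ D.W, ∀ y ∈ D.nbr x, 0 ≤ d x y) {t : ℝ} (ht : 0 ≤ t)
    (hroww : ∀ x ∈ D.W, ∑ y ∈ D.nbr x, D.C x y * Real.exp (t * d x y) ≤ c)
    (ρ : V → ℝ) (hρW : ∀ y ∉ D.W, ρ y ≤ 0) (hρ : ∀ x ∈ D.W, ∀ y ∈ D.nbr x, ρ x ≤ ρ y + d x y)
    {f : (V → S) → ℝ} {Δ : Finset V} {δ : V → ℝ} (hf : D.P f Δ) (hδ : IsLipBound D.r f δ)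
    (hδ0 : ∀ y ∉ Δ, δ y = 0) :
    |E₁ f - E₂ f| ≤ D.R * ∑ y ∈ Δ, Real.exp (-(t * ρ y)) * δ y := by
  -- the plain row condition follows from the weighted one since `e^{t d} ≥ 1`
  have hrow : ∀ x ∈ D.W, ∑ y ∈ D.nbr x, D.C x y ≤ c := fun x hx => by
    refine le_trans (Finset.sum_le_sum fun y hy => ?_) (hroww x hx)
    have h1 : (1 : ℝ) ≤ Real.exp (t * d x y) := Real.one_le_exp (mul_nonneg ht (hd x hx y hy))
    have h2 := mul_le_mul_of_nonneg_left h1 (D.C_nonneg x y)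
    rwa [mul_one] at h2
  -- the weight `θ = e^{-t ρ}` satisfies the hypotheses of `abs_sub_le_sum_weighted`
  refine abs_sub_le_sum_weighted h₁ h₂ hc0 hc1 hrow (θ := fun y => Real.exp (-(t * ρ y)))
    (fun y => (Real.exp_pos _).le) (fun y hy => ?_) (fun x hx => ?_) hf hδ hδ0
  · exact Real.one_le_exp (by nlinarith [hρW y hy])
  · calc ∑ y ∈ D.nbr x, D.C x y * Real.exp (-(t * ρ y))
        ≤ ∑ y ∈ D.nbr x, D.C x y * Real.exp (t * d x y) * Real.exp (-(t * ρ x)) := by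
          refine Finset.sum_le_sum fun y hy => ?_
          rw [mul_assoc, ← Real.exp_add]
          refine mul_le_mul_of_nonneg_left (Real.exp_le_exp.2 ?_) (D.C_nonneg x y)
          nlinarith [hρ x hx y hy]
      _ = (∑ y ∈ D.nbr x, D.C x y * Real.exp (t * d x y)) * Real.exp (-(t * ρ x)) :=
          (Finset.sum_mul _ _ _).symm
      _ ≤ c * Real.exp (-(t * ρ x)) :=
          mul_le_mul_of_nonneg_right (hroww x hx) (Real.exp_pos _).le

end DustingData

/-! ### Covariance decay for Gibbs measures under the weighted condition -/

section States

variable [MeasurableSpace S] {γ : Specification V S} {r : S → S → ℝ} {nbr : V → Finset V}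
  {C : V → V → ℝ}

/-- The weighted row sums of the dusting data `krDustingData` are the weighted Dobrushin sums
`∑_{y ∈ nbr x} C x y · a y`. [cite: Follmer1988, Ch. I (2.7)] -/
theorem sum_krDustingData_C_mul [DecidableEq V] (hγ : IsSpecification γ)
    (hC : IsKRContraction γ r nbr C) {R : ℝ} (hr0 : ∀ a b, 0 ≤ r a b) (hrR : ∀ a b, r a b ≤ R)
    (hR : 0 ≤ R) (W : Set V) (a : V → ℝ) (x : V) :
    ∑ y ∈ (krDustingData hγ hC hr0 hrR hR W).nbr x,
        (krDustingData hγ hC hr0 hrR hR W).C x y * a y = ∑ y ∈ nbr x, C x y * a y := by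
  change ∑ y ∈ nbr x, (if y ∈ nbr x then C x y else 0) * a y = _
  exact Finset.sum_congr rfl fun y hy => by rw [if_pos hy]

/-- **Covariance estimate in Dobrushin's regime under the WEIGHTED row-sum condition, Vasserstein
form** (Föllmer 1988, Ch. I, Thm. (2.13)/(2.23) with Cor. (2.14)/(2.24); Georgii 2011, Remark 8.26
and §8.2; Künsch 1982 — twin of `abs_covariance_le_of_isKRContraction`): let the one-site kernels
of `γ` satisfy Dobrushin's condition in the Vasserstein form for a weight `0 ≤ r ≤ R`, let `μ` be a
Gibbs measure, `f, g` bounded measurable local observables with Lipschitz bounds `δ_f, δ_g` and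
dependence sets `Δ_f, Δ_g`; suppose that OFF `Δ_g` the plain rows are `≤ c < 1` and a weight
`θ ≥ 0` with `θ ≥ 1` on `Δ_g` satisfies `∑_{y ∈ nbr x} C x y θ y ≤ c θ x`. Then
`|cov_μ(f, g)| ≤ 2 R² (∑_{y ∈ Δ_g} δ_g y) ∑_{y ∈ Δ_f} θ y δ_f y`.
Proof: `cov(f, g) = μ(g̃) (μ_{g̃}(f) - μ(f))` for the tilt of `μ` by
`g̃ = g - g(τ₀) + R ∑ δ_g ∈ [0, 2 R ∑ δ_g]`, an invariant state off `Δ_g`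
(`isInvariantState_tilt`), and `abs_sub_le_sum_weighted` bounds `|μ_{g̃}(f) - μ(f)|` by
`R ∑ θ δ_f`. [cite: Follmer1988, Ch. I Theorem (2.13)] -/
theorem abs_covariance_le_of_isKRContraction_weighted [DecidableEq V] (hγ : IsSpecification γ)
    (hC : IsKRContraction γ r nbr C) {R : ℝ} (hr0 : ∀ a b, 0 ≤ r a b) (hrR : ∀ a b, r a b ≤ R)
    (hR : 0 ≤ R) {μ : Measure (V → S)} (hμ : IsGibbsMeasure γ μ) {f g : (V → S) → ℝ}
    (hfm : Measurable f) {Δf : Finset V} (hfdep : DependsOn f (↑Δf : Set V)) {Mf : ℝ}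
    (hMf : ∀ σ, |f σ| ≤ Mf) {δf : V → ℝ} (hδf : IsLipBound r f δf) (hgm : Measurable g)
    {Δg : Finset V} (hgdep : DependsOn g (↑Δg : Set V)) {Mg : ℝ} (hMg : ∀ σ, |g σ| ≤ Mg)
    {δg : V → ℝ} (hδg : IsLipBound r g δg) {c : ℝ} (hc0 : 0 ≤ c) (hc1 : c < 1)
    (hrow : ∀ x ∉ Δg, ∑ y ∈ nbr x, C x y ≤ c) {θ : V → ℝ} (hθ0 : ∀ y, 0 ≤ θ y)
    (hθg : ∀ y ∈ Δg, 1 ≤ θ y) (hroww : ∀ x ∉ Δg, ∑ y ∈ nbr x, C x y * θ y ≤ c * θ x) :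
    |cov[f, g; μ]| ≤ 2 * R ^ 2 * (∑ y ∈ Δg, δg y) * ∑ y ∈ Δf, θ y * δf y := by
  haveI := hμ.isProbabilityMeasure
  obtain ⟨τ₀, -⟩ := nonempty_of_measure_ne_zero (μ := μ) (s := Set.univ) (by simp)
  -- the shifted density `g̃ ∈ [0, 2 S_g]`
  set Sg : ℝ := R * ∑ y ∈ Δg, δg y with hSg
  have hSg0 : 0 ≤ Sg := mul_nonneg hR (Finset.sum_nonneg fun y _ => hδg.nonneg y)
  set gt : (V → S) → ℝ := fun σ => g σ + (Sg - g τ₀) with hgt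
  have hosc : ∀ σ, |g σ - g τ₀| ≤ Sg := fun σ =>
    abs_sub_le_mul_sum_of_dependsOn hrR hgdep hδg σ τ₀
  have hgt0 : ∀ σ, 0 ≤ gt σ := fun σ => by
    have := (abs_le.1 (hosc σ)).1; simp only [hgt]; linarith
  have hgtB : ∀ σ, gt σ ≤ 2 * Sg := fun σ => by
    have := (abs_le.1 (hosc σ)).2; simp only [hgt]; linarith
  have hgtm : Measurable gt := hgm.add_const _
  have hgtdep : DependsOn gt (↑Δg : Set V) := fun σ τ h => by
    simp only [hgt]; rw [hgdep h]
  have hgi : Integrable g μ := integrable_of_abs_le' hgm hMg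
  have hfi : Integrable f μ := integrable_of_abs_le' hfm hMf
  have hgtabs : ∀ σ, |gt σ| ≤ 2 * Sg := fun σ => by
    rw [abs_of_nonneg (hgt0 σ)]; exact hgtB σ
  have hgti : Integrable gt μ := integrable_of_abs_le' hgtm hgtabs
  -- the right-hand side is nonnegative
  have hRHS : 0 ≤ 2 * R ^ 2 * (∑ y ∈ Δg, δg y) * ∑ y ∈ Δf, θ y * δf y := by
    have h1 : 0 ≤ ∑ y ∈ Δg, δg y := Finset.sum_nonneg fun y _ => hδg.nonneg y
    have h2 : 0 ≤ ∑ y ∈ Δf, θ y * δf y :=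
      Finset.sum_nonneg fun y _ => mul_nonneg (hθ0 y) (hδf.nonneg y)
    positivity
  -- `cov(f, g) = cov(f, g̃) = μ(f g̃) - μ(f) μ(g̃)`
  have hcov : cov[f, g; μ] = ∫ σ, f σ * gt σ ∂μ - (∫ σ, f σ ∂μ) * ∫ σ, gt σ ∂μ := by
    have h1 : cov[f, g; μ] = cov[f, gt; μ] := by
      rw [hgt, covariance_add_const_right hgi]
    rw [h1, covariance_eq_sub]
    · rfl
    · exact memLp_of_bounded (a := -Mf) (b := Mf)
        (ae_of_all _ fun σ => abs_le.1 (hMf σ)) hfm.aestronglyMeasurable 2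
    · exact memLp_of_bounded (a := -(2 * Sg)) (b := 2 * Sg)
        (ae_of_all _ fun σ => abs_le.1 (hgtabs σ)) hgtm.aestronglyMeasurable 2
  by_cases hz : ∫ σ, gt σ ∂μ = 0
  · -- degenerate case: `g̃ = 0` a.e., so the covariance vanishes
    have hae : gt =ᵐ[μ] 0 := (integral_eq_zero_iff_of_nonneg (fun σ => hgt0 σ) hgti).1 hz
    have hfg : ∫ σ, f σ * gt σ ∂μ = 0 := by
      rw [← integral_zero (α := V → S) (μ := μ) (G := ℝ)]
      refine integral_congr_ae ?_
      filter_upwards [hae] with σ hσ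
      simp [hσ]
    rw [hcov, hfg, hz, mul_zero, sub_zero, abs_zero]
    exact hRHS
  have hpos : 0 < ∫ σ, gt σ ∂μ :=
    lt_of_le_of_ne (integral_nonneg hgt0) (Ne.symm hz)
  -- the weighted comparison estimate between `μ` and its tilt by `g̃`
  let D := krDustingData hγ hC hr0 hrR hR ((↑Δg : Set V)ᶜ)
  have h₁ := isInvariantState_integral_of_isGibbsMeasure hγ hC hr0 hrR hR ((↑Δg : Set V)ᶜ) hμ
  have h₂ := isInvariantState_tilt hγ hC hr0 hrR hR hμ hgtm hgtdep hgt0 hgtB hpos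
  have hδf' := hδf.restrict hfdep
  have hW : ∀ x, x ∈ ((↑Δg : Set V)ᶜ) → x ∉ Δg := fun x hx h' =>
    (Set.mem_compl_iff _ _).1 hx (Finset.mem_coe.2 h')
  have key := DustingData.abs_sub_le_sum_weighted (D := D) h₁ h₂ hc0 hc1
    (fun x (hx : x ∈ ((↑Δg : Set V)ᶜ)) =>
      (sum_krDustingData_C hγ hC hr0 hrR hR _ x).le.trans (hrow x (hW x hx)))
    (θ := θ) hθ0 (fun y (hy : y ∉ ((↑Δg : Set V)ᶜ)) => hθg y (by simpa using hy))
    (fun x (hx : x ∈ ((↑Δg : Set V)ᶜ)) =>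
      (sum_krDustingData_C_mul hγ hC hr0 hrR hR _ θ x).le.trans (hroww x (hW x hx)))
    (f := f) (Δ := Δf) ⟨hfm, hfdep, Mf, hMf⟩ hδf' (fun y hy => if_neg hy)
  -- unfold the two states in `key`
  have hsum : ∑ y ∈ Δf, θ y * (if y ∈ Δf then δf y else 0) = ∑ y ∈ Δf, θ y * δf y :=
    Finset.sum_congr rfl fun y hy => by rw [if_pos hy]
  have key' : |∫ σ, f σ ∂μ - (∫ σ, gt σ * f σ ∂μ) / ∫ σ, gt σ ∂μ| ≤
      R * ∑ y ∈ Δf, θ y * δf y := by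
    rw [← hsum]; exact key
  -- `cov = μ(g̃) · (μ_{g̃}(f) - μ(f))`
  have hfgt : ∫ σ, f σ * gt σ ∂μ = ∫ σ, gt σ * f σ ∂μ :=
    integral_congr_ae (ae_of_all _ fun σ => mul_comm _ _)
  have hident : cov[f, g; μ] =
      (∫ σ, gt σ ∂μ) * ((∫ σ, gt σ * f σ ∂μ) / ∫ σ, gt σ ∂μ - ∫ σ, f σ ∂μ) := by
    rw [hcov, hfgt, mul_sub, mul_div_cancel₀ _ hz]
    ring
  rw [hident, abs_mul, abs_of_pos hpos, abs_sub_comm]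
  have hgtint : ∫ σ, gt σ ∂μ ≤ 2 * Sg := by
    calc ∫ σ, gt σ ∂μ ≤ ∫ _σ, 2 * Sg ∂μ := integral_mono hgti (integrable_const _) hgtB
      _ = 2 * Sg := by simp
  calc (∫ σ, gt σ ∂μ) * |∫ σ, f σ ∂μ - (∫ σ, gt σ * f σ ∂μ) / ∫ σ, gt σ ∂μ|
      ≤ (2 * Sg) * (R * ∑ y ∈ Δf, θ y * δf y) :=
        mul_le_mul hgtint key' (abs_nonneg _) (by positivity)
    _ = 2 * R ^ 2 * (∑ y ∈ Δg, δg y) * ∑ y ∈ Δf, θ y * δf y := by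
        rw [hSg]; ring

/-- **Exponential decay of covariances under the weighted Dobrushin condition, Vasserstein form**
(Föllmer 1988, Ch. I, (2.23)–(2.24): "exponential decay of correlation follows as in (2.14): if
`κ̄ < 1` …"; Georgii 2011, Remark 8.26; Künsch 1982): with `d x y ≥ 0` on `y ∈ nbr x`, `t ≥ 0`,
the WEIGHTED ROW SUMS `∑_{y ∈ nbr x} C x y e^{t d x y} ≤ c < 1` off `Δ_g`, and a profile `ρ` with
`ρ ≤ 0` on `Δ_g` and `ρ x ≤ ρ y + d x y` for `y ∈ nbr x`, `x ∉ Δ_g` (e.g. the `d`-distance to `Δ_g`):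
`|cov_μ(f, g)| ≤ 2 R² (∑_{y ∈ Δ_g} δ_g y) ∑_{y ∈ Δ_f} e^{-t ρ y} δ_f y`. The sets `nbr x` may be
all other sites of a finite volume: the rate `t` comes from the weight, not from the range.
[cite: Follmer1988, Ch. I Corollary (2.14)] -/
theorem abs_covariance_le_of_isKRContraction_exp_profile [DecidableEq V] (hγ : IsSpecification γ)
    (hC : IsKRContraction γ r nbr C) {R : ℝ} (hr0 : ∀ a b, 0 ≤ r a b) (hrR : ∀ a b, r a b ≤ R)
    (hR : 0 ≤ R) {μ : Measure (V → S)} (hμ : IsGibbsMeasure γ μ) {f g : (V → S) → ℝ}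
    (hfm : Measurable f) {Δf : Finset V} (hfdep : DependsOn f (↑Δf : Set V)) {Mf : ℝ}
    (hMf : ∀ σ, |f σ| ≤ Mf) {δf : V → ℝ} (hδf : IsLipBound r f δf) (hgm : Measurable g)
    {Δg : Finset V} (hgdep : DependsOn g (↑Δg : Set V)) {Mg : ℝ} (hMg : ∀ σ, |g σ| ≤ Mg)
    {δg : V → ℝ} (hδg : IsLipBound r g δg) {c : ℝ} (hc0 : 0 ≤ c) (hc1 : c < 1)
    (d : V → V → ℝ) (hd : ∀ x ∉ Δg, ∀ y ∈ nbr x, 0 ≤ d x y) {t : ℝ} (ht : 0 ≤ t)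
    (hroww : ∀ x ∉ Δg, ∑ y ∈ nbr x, C x y * Real.exp (t * d x y) ≤ c)
    (ρ : V → ℝ) (hρg : ∀ y ∈ Δg, ρ y ≤ 0) (hρ : ∀ x ∉ Δg, ∀ y ∈ nbr x, ρ x ≤ ρ y + d x y) :
    |cov[f, g; μ]| ≤
      2 * R ^ 2 * (∑ y ∈ Δg, δg y) * ∑ y ∈ Δf, Real.exp (-(t * ρ y)) * δf y := by
  -- plain rows from the weighted rows (`e^{t d} ≥ 1`)
  have hrow : ∀ x ∉ Δg, ∑ y ∈ nbr x, C x y ≤ c := fun x hx => by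
    refine le_trans (Finset.sum_le_sum fun y hy => ?_) (hroww x hx)
    have h1 : (1 : ℝ) ≤ Real.exp (t * d x y) := Real.one_le_exp (mul_nonneg ht (hd x hx y hy))
    have h2 := mul_le_mul_of_nonneg_left h1 (hC.nonneg x y)
    rwa [mul_one] at h2
  refine abs_covariance_le_of_isKRContraction_weighted hγ hC hr0 hrR hR hμ hfm hfdep hMf hδf hgm
    hgdep hMg hδg hc0 hc1 hrow (θ := fun y => Real.exp (-(t * ρ y)))
    (fun y => (Real.exp_pos _).le) (fun y hy => Real.one_le_exp (by nlinarith [hρg y hy]))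
    (fun x hx => ?_)
  calc ∑ y ∈ nbr x, C x y * Real.exp (-(t * ρ y))
      ≤ ∑ y ∈ nbr x, C x y * Real.exp (t * d x y) * Real.exp (-(t * ρ x)) := by
        refine Finset.sum_le_sum fun y hy => ?_
        rw [mul_assoc, ← Real.exp_add]
        refine mul_le_mul_of_nonneg_left (Real.exp_le_exp.2 ?_) (hC.nonneg x y)
        nlinarith [hρ x hx y hy]
    _ = (∑ y ∈ nbr x, C x y * Real.exp (t * d x y)) * Real.exp (-(t * ρ x)) :=
        (Finset.sum_mul _ _ _).symm
    _ ≤ c * Real.exp (-(t * ρ x)) :=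
        mul_le_mul_of_nonneg_right (hroww x hx) (Real.exp_pos _).le

/-- **Exponential clustering at distance `m`** (Föllmer 1988, Ch. I, (2.24); Künsch 1982;
Georgii 2011, Remark 8.26 — the form used for lattice models: observables whose supports are at
`d`-distance `≥ m`): under the hypotheses of `abs_covariance_le_of_isKRContraction_exp_profile`, if
moreover `ρ ≥ m` on `Δ_f`, then
`|cov_μ(f, g)| ≤ 2 R² (∑_{Δ_g} δ_g) (∑_{Δ_f} δ_f) e^{-t m}` — a bound uniform in the index set `V`
as soon as the weighted row-sum constant `c` is. [cite: Follmer1988, Ch. I Corollary (2.14)] -/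
theorem abs_covariance_le_of_isKRContraction_exp_dist [DecidableEq V] (hγ : IsSpecification γ)
    (hC : IsKRContraction γ r nbr C) {R : ℝ} (hr0 : ∀ a b, 0 ≤ r a b) (hrR : ∀ a b, r a b ≤ R)
    (hR : 0 ≤ R) {μ : Measure (V → S)} (hμ : IsGibbsMeasure γ μ) {f g : (V → S) → ℝ}
    (hfm : Measurable f) {Δf : Finset V} (hfdep : DependsOn f (↑Δf : Set V)) {Mf : ℝ}
    (hMf : ∀ σ, |f σ| ≤ Mf) {δf : V → ℝ} (hδf : IsLipBound r f δf) (hgm : Measurable g)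
    {Δg : Finset V} (hgdep : DependsOn g (↑Δg : Set V)) {Mg : ℝ} (hMg : ∀ σ, |g σ| ≤ Mg)
    {δg : V → ℝ} (hδg : IsLipBound r g δg) {c : ℝ} (hc0 : 0 ≤ c) (hc1 : c < 1)
    (d : V → V → ℝ) (hd : ∀ x ∉ Δg, ∀ y ∈ nbr x, 0 ≤ d x y) {t : ℝ} (ht : 0 ≤ t)
    (hroww : ∀ x ∉ Δg, ∑ y ∈ nbr x, C x y * Real.exp (t * d x y) ≤ c)
    (ρ : V → ℝ) (hρg : ∀ y ∈ Δg, ρ y ≤ 0) (hρ : ∀ x ∉ Δg, ∀ y ∈ nbr x, ρ x ≤ ρ y + d x y)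
    {m : ℝ} (hm : ∀ y ∈ Δf, m ≤ ρ y) :
    |cov[f, g; μ]| ≤
      2 * R ^ 2 * (∑ y ∈ Δg, δg y) * (∑ y ∈ Δf, δf y) * Real.exp (-(t * m)) := by
  refine (abs_covariance_le_of_isKRContraction_exp_profile hγ hC hr0 hrR hR hμ hfm hfdep hMf hδf
    hgm hgdep hMg hδg hc0 hc1 d hd ht hroww ρ hρg hρ).trans ?_
  have h1 : ∑ y ∈ Δf, Real.exp (-(t * ρ y)) * δf y ≤ ∑ y ∈ Δf, Real.exp (-(t * m)) * δf y :=
    Finset.sum_le_sum fun y hy => mul_le_mul_of_nonneg_right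
      (Real.exp_le_exp.2 (by nlinarith [hm y hy])) (hδf.nonneg y)
  have h2 : 0 ≤ 2 * R ^ 2 * ∑ y ∈ Δg, δg y := by
    have : 0 ≤ ∑ y ∈ Δg, δg y := Finset.sum_nonneg fun y _ => hδg.nonneg y
    positivity
  calc 2 * R ^ 2 * (∑ y ∈ Δg, δg y) * ∑ y ∈ Δf, Real.exp (-(t * ρ y)) * δf y
      ≤ 2 * R ^ 2 * (∑ y ∈ Δg, δg y) * ∑ y ∈ Δf, Real.exp (-(t * m)) * δf y :=
        mul_le_mul_of_nonneg_left h1 h2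
    _ = 2 * R ^ 2 * (∑ y ∈ Δg, δg y) * (∑ y ∈ Δf, δf y) * Real.exp (-(t * m)) := by
        rw [← Finset.mul_sum]; ring

/-- **Exponential clustering in the distance to the support of `g`** (Föllmer 1988, Ch. I,
Cor. (2.14)/(2.24) for a semimetric on the sites; Künsch 1982; Georgii 2011, Remark 8.26): on a
pseudo-metric space of sites, if the weighted row sums `∑_{y ∈ nbr x} C x y e^{t · dist x y}` are
`≤ c < 1` off `Δ_g` (`t ≥ 0`), then
`|cov_μ(f, g)| ≤ 2 R² (∑_{Δ_g} δ_g) ∑_{y ∈ Δ_f} e^{-t · infDist(y, Δ_g)} δ_f y`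
(`ρ = infDist(·, Δ_g)` vanishes on `Δ_g` and is `1`-Lipschitz). [cite: Follmer1988, Ch. I Corollary (2.14)] -/
theorem abs_covariance_le_of_isKRContraction_infDist [PseudoMetricSpace V] [DecidableEq V]
    (hγ : IsSpecification γ) (hC : IsKRContraction γ r nbr C) {R : ℝ} (hr0 : ∀ a b, 0 ≤ r a b)
    (hrR : ∀ a b, r a b ≤ R) (hR : 0 ≤ R) {μ : Measure (V → S)} (hμ : IsGibbsMeasure γ μ)
    {f g : (V → S) → ℝ} (hfm : Measurable f) {Δf : Finset V}
    (hfdep : DependsOn f (↑Δf : Set V)) {Mf : ℝ} (hMf : ∀ σ, |f σ| ≤ Mf) {δf : V → ℝ}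
    (hδf : IsLipBound r f δf) (hgm : Measurable g) {Δg : Finset V}
    (hgdep : DependsOn g (↑Δg : Set V)) {Mg : ℝ} (hMg : ∀ σ, |g σ| ≤ Mg) {δg : V → ℝ}
    (hδg : IsLipBound r g δg) {c : ℝ} (hc0 : 0 ≤ c) (hc1 : c < 1) {t : ℝ} (ht : 0 ≤ t)
    (hroww : ∀ x ∉ Δg, ∑ y ∈ nbr x, C x y * Real.exp (t * dist x y) ≤ c) :
    |cov[f, g; μ]| ≤ 2 * R ^ 2 * (∑ y ∈ Δg, δg y) *
      ∑ y ∈ Δf, Real.exp (-(t * Metric.infDist y (↑Δg : Set V))) * δf y :=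
  abs_covariance_le_of_isKRContraction_exp_profile hγ hC hr0 hrR hR hμ hfm hfdep hMf hδf hgm hgdep
    hMg hδg hc0 hc1 (fun x y => dist x y) (fun _ _ _ _ => dist_nonneg) ht hroww
    (fun y => Metric.infDist y (↑Δg : Set V))
    (fun _ hy => (Metric.infDist_zero_of_mem (Finset.mem_coe.2 hy)).le)
    (fun _ _ _ _ => Metric.infDist_le_infDist_add_dist)

end States

end DobrushinMetric

end Literature.Probability.LatticeModels
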